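import Summits.CriticalPhenomena.PercolationContinuityZ3.Theorems.PercNearOneGluingNoHeavyConstsFibrewiseBHK
import HarnessLib
import HarnessLib.Audit.Tags

/-!
# CONJECTURE "hard-core two-copy BHK" (HC⁺) — a parameter-free statement that IMPLIES the fibrewise
# van den Berg–Häggström–Kahn conjecture `Consts.FibrewiseBHK` (PA-BERN), with the reduction theorem (pencil)
# and the exact census (PAPER-2 track (ii): constants of the CSH family)

builds on p205010 (kernel theorem, internal audit signed; external expert review pending).  Support file (`--supports
stmt-CriticalPhenomena-4575`), lead seat `prim-nh-lead-4575` (gen 105); memo `run/shared/lean/prim/prim-nh-lead-4575/LEAD-GEN105.md` §1;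
engines + kit bundle `run/shared/lean/prim/prim-nh-lead-4575/lab-gen105/hc/`.  One `Prop` definition (an OPEN counting statement,
tagged `@[conjecture]`), two theorems; no sorries; standard axioms.

SETTING (as in `…ConstsFibrewiseBHK.lean`): configurations `a : BondConfig (Fin n)`; a folding fibre `(M, u)` consists of the
`a` with `a \ M = u`, paired with the reflection `a ∆ M` (the two copies `(η₀, η₁) = (a, a ∆ M)` have a fixed two-copy profile);
`C_S(ω) = ⋃_{s ∈ S} C_s(ω)` is the union edge cluster, `B = {S ↮ T}`.  NEW INGREDIENT: a HARD-CORE set `N` of vertices and the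
pair condition `HC_N(η₀, η₁)`: no vertex of `N` is joined to `S` in BOTH copies.

* `Consts.HardCoreBHK` — **CONJECTURE (HC⁺) (OPEN, this programme)**: for all `n, S, T, N`, increasing `P, Q`, and every fibre,
  `#{a : a∖M = u, HC_N(a, a∆M), a ∈ B∩{P(C_S)}, a∆M ∈ B∩{Q(C_S)}} ≤ #{a : a∖M = u, HC_N(a, a∆M), a ∈ B∩{P}∩{Q}, a∆M ∈ B}`.
  `N = ∅` is `Consts.FibrewiseBHK` (`Consts.fibrewiseBHK_of_hardCoreBHK` below); `T = ∅` is the "hard-core Harris" inequality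
  (HC): on the whole cube, with NO conditioning, `Σ_{pairs with HC_N} 1_P(η₀)(1_Q(η₀) − 1_Q(η₁)) ≥ 0`; `T = N = ∅` is Harris
  fibrewise (`Consts.hardCoreBHK_of_empty`, Kleitman twice).
* **REDUCTION THEOREM (lead gen 105, pencil; memo §1): (HC) for all finite multigraphs ⟹ (HC⁺) for all finite multigraphs
  ⟹ `FibrewiseBHK` ⟹ the SIGN LEMMA of `Consts.MDLXJointBernstein` (gen 104).**  Proof of the first implication, by
  induction on the number of vertices outside `T`: in the antipodal form on a multigraph `G` (general fibres = antipodal fibres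
  of minors) split a configuration as `η = (η_F, ξ)`, `F` = the edges between `T` and `V∖T`, `ξ` a configuration of `G' = G − T`
  (edges inside `T` are irrelevant; if `S` meets `T` or is adjacent to `T` both sides vanish).  On `B ∩ σB` the clusters of both
  copies are clusters of `G'`, and for fixed `(ξ, σξ)` the number of compatible `η_F` is `∏_{v ∈ N(T)} c_v` with
  `c_v = 2^{f(v)}, 1, 1, 0` according as `v` is joined to `S` in neither copy / copy 0 only / copy 1 only / both (`f(v)` = number
  of `T`-edges at `v`: joined in copy 0 forces them closed in `η`, joined in copy 1 forces them open in `η`).  INTEGER IDENTITY: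
  `c_v = hc_v + (2^{f(v)} − 1)·rep_v` with `hc_v = 1,1,1,0` (hard-core weight) and `rep_v = 1,0,0,0` (two-sided repulsion);
  expanding `∏_v (hc_v + (2^{f(v)}−1) rep_v)` writes BOTH sides of (HC⁺)(G,S,T,N) as the SAME nonnegative integer combination,
  over `N₁ ⊆ N(T)`, of the two sides of (HC⁺)(G', S, T' = N(T)∖N₁, N ∪ N₁) — instances with fewer vertices outside the repelled
  set unless `T' = ∅`, which is (HC) itself on `G'`.  ∎   (Equivalently: the pair weight is multilinear in `t_v = 2^{−f(v)} ∈ [0,1]`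
  and nonpositivity at the corners `t ∈ {0,1}^{N(T)}` suffices.)  GRADIENT FORM: every statement of this family reads
  `Σ_ξ K(ξ,σξ)·∇a(ξ)·∇b(ξ) ≥ 0` with `∇a = a − a∘σ` (odd, increasing) and a σ-symmetric pair weight `K` (`K ≡ 1`: Harris).
* EVIDENCE (exact, lead gen 105; engine `hcbern.c`: per `(G,S,T,N,U_i,U_j)` the two profile tables over all pairs; negated control
  violates in 1,878/2,100 instances; kit self-test = hub numbers): **0 violations** of (HC⁺) with `N ≠ ∅` for the connection events
  `{a ↔ b}` (`a ∈ S`) and (ext) their pairwise OR/AND and the cluster-size events, over ALL `T` and ALL `N`: all graphs `n ≤ 4`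
  (ext, 10,482 instances / 324,304 profile rows), `n = 5` (ext, `|S| ≤ 2`: 528,628 / 2.60·10⁸), `n = 6, m ≤ 8` (ext, all 70 graphs:
  11,763,405 / 3.35·10⁹), `n = 6, m = 9–12` and `n = 7, m ≤ 9` (points, `|S| ≤ 2`; kit j160350–j160395, complete families in the
  memo); and of the bilinear ALL-UP-SETS form (every increasing `P` against every increasing `Q` of the poset of realizable cluster
  vertex sets, exact min-closure) on all graphs `n ≤ 4`, all fibres (51,999 fibres; edge-set posets 51,833 fibres).  Refinements that
  are FALSE already at `n = 4` (so (HC) is the right level): the pointwise-in-the-doubly-reached-set form and monotonicity in `N`.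
  STRONGER forms with 0 violations on `n ≤ 5` (all `S,T,N`, 9.9·10⁷ rows; engine `assoc.c`): under the uniform measure on the pairs of a
  fibre satisfying `B × B` and `HC_N`, (G-a) increasing events of `C_S(η₀)` are positively correlated and (G-b) an increasing event of
  `C_S(η₀)` and one of `C_S(η₁)` are negatively correlated — the two-copy analogues of BHK's Theorems 1.3 and 1.4; (G-a) ∧ (G-b) ⟹ (HC⁺).
* `Consts.fibrewiseBHK_of_hardCoreBHK` — **THEOREM**: `HardCoreBHK → FibrewiseBHK` (`N = ∅`).
* `Consts.hardCoreBHK_of_empty` — **THEOREM**: the conjecture holds for `T = ∅, N = ∅` (Harris fibrewise; via gen 104's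
  `Consts.fibrewiseBHK_of_repel_empty`; stated with hypotheses `T = ∅`, `N = ∅` so that the filter predicates elaborate with the
  same decidability instances as the conjecture).
[cite: VandenbergHaggstromKahn2005, Thm. 1.3 (p. 6), Thm. 1.1 (pp. 3–5: the induction splitting off `Z = X ∩ Y`), Thm. 1.4 (p. 6)]
[cite: Linusson2011, Prop. 2.6] [cite: Kleitman1966, Lemma] [status: open]
-/

noncomputable section

namespace Summit.CriticalPhenomena.PercolationContinuityZ3.Theorems

open MeasureTheory Set Literature.Probability.LatticeModels Literature.Probability.Percolation
open scoped Classical symmDiff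

namespace Consts

/-- **CONJECTURE (HC⁺) — "hard-core two-copy BHK" (OPEN).**  For every `n`, source set `S`, repelled set `T`, hard-core set `N`,
increasing predicates `P, Q` of edge sets (read on the union cluster `C_S`), and every folding fibre `(M, u)` (`u` disjoint from `M`):
with `B = {ω | ∀ s ∈ S, ∀ t ∈ T, ¬ s ↔ t}` and the pair condition `HC_N(a, a ∆ M)` = "no `v ∈ N` is joined to `S` both in `a` and
in `a ∆ M`",
`#{a : a∖M = u, HC_N, a ∈ B∩{P(C_S)}, a∆M ∈ B∩{Q(C_S)}} ≤ #{a : a∖M = u, HC_N, a ∈ B∩{P(C_S)}∩{Q(C_S)}, a∆M ∈ B}`.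
`N = ∅` is `Consts.FibrewiseBHK`; `T = ∅` ("hard-core Harris") already implies the whole statement (reduction theorem, module
docstring; pencil).  Exact census (lead gen 105): 0 violations on all graphs with `n ≤ 5` (all `S` with `|S| ≤ 2`, all `T`, all `N`,
connection events and their OR/AND/size combinations), `n = 6, m ≤ 8` (same), `n = 6, m ≤ 12` and `n = 7, m ≤ 9` (points).
[cite: VandenbergHaggstromKahn2005, Thm. 1.3 (p. 6) with Remark 1 after Thm. 1.2 (p. 5), Thm. 1.1 (pp. 3–5)] [cite: Linusson2011, Prop. 2.6]
[status: open] -/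
@[conjecture] def HardCoreBHK : Prop :=
  ∀ (n : ℕ) (S T N : Set (Fin n)) (P Q : Set (Sym2 (Fin n)) → Prop),
    (∀ ⦃C C' : Set (Sym2 (Fin n))⦄, C ⊆ C' → P C → P C') →
    (∀ ⦃C C' : Set (Sym2 (Fin n))⦄, C ⊆ C' → Q C → Q C') →
    ∀ M u : Set (Sym2 (Fin n)), Disjoint u M →
      (Finset.univ.filter fun a : BondConfig (Fin n) =>
          a \ M = u ∧
            (∀ v ∈ N, ¬ ((∃ s ∈ S, (openGraph a).Reachable s v) ∧ (∃ s ∈ S, (openGraph (a ∆ M)).Reachable s v))) ∧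
            a ∈ ({ω : BondConfig (Fin n) | ∀ s ∈ S, ∀ t ∈ T, ¬ (openGraph ω).Reachable s t} ∩
                  {ω | P (⋃ s ∈ S, openEdgeCluster ω s)}) ∧
            a ∆ M ∈ ({ω : BondConfig (Fin n) | ∀ s ∈ S, ∀ t ∈ T, ¬ (openGraph ω).Reachable s t} ∩
                  {ω | Q (⋃ s ∈ S, openEdgeCluster ω s)})).card ≤
      (Finset.univ.filter fun a : BondConfig (Fin n) =>
          a \ M = u ∧
            (∀ v ∈ N, ¬ ((∃ s ∈ S, (openGraph a).Reachable s v) ∧ (∃ s ∈ S, (openGraph (a ∆ M)).Reachable s v))) ∧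
            a ∈ ({ω : BondConfig (Fin n) | ∀ s ∈ S, ∀ t ∈ T, ¬ (openGraph ω).Reachable s t} ∩
                  {ω | P (⋃ s ∈ S, openEdgeCluster ω s)} ∩ {ω | Q (⋃ s ∈ S, openEdgeCluster ω s)}) ∧
            a ∆ M ∈ {ω : BondConfig (Fin n) | ∀ s ∈ S, ∀ t ∈ T, ¬ (openGraph ω).Reachable s t}).card

/-- **`HardCoreBHK → FibrewiseBHK`**: the fibrewise van den Berg–Häggström–Kahn conjecture (PA-BERN, `…ConstsFibrewiseBHK.lean`)
is the slice `N = ∅` of the hard-core conjecture (the pair condition is then vacuous).  With the pencil reduction theorem of the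
module docstring, the slice `T = ∅` ("hard-core Harris") conversely implies all of `HardCoreBHK`.
[cite: VandenbergHaggstromKahn2005, Thm. 1.3 (p. 6)] -/
theorem fibrewiseBHK_of_hardCoreBHK (h : HardCoreBHK) : FibrewiseBHK := by
  intro n S T P Q hP hQ M u hu
  have key := h n S T (∅ : Set (Fin n)) P Q hP hQ M u hu
  -- `convert` absorbs the (subsingleton) decidability instances of the two filters; the predicates agree because the
  -- hard-core clause over `N = ∅` is vacuous
  convert key using 2 <;>
  · ext a
    simp only [Finset.mem_filter, Finset.mem_univ, true_and, Set.mem_empty_iff_false, false_implies, implies_true]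

/-- **The conjecture holds when nothing is repelled and the hard-core set is empty (`T = ∅`, `N = ∅`)**: then both constraints are
vacuous and the fibre inequality is Harris' inequality fibrewise for the two increasing events `{P(C_S)}`, `{Q(C_S)}` ("Kleitman
twice" on the fibre) — gen 104's `Consts.fibrewiseBHK_of_repel_empty`. [cite: Kleitman1966, Lemma] [cite: Harris1960, Lemma 4.1] -/
theorem hardCoreBHK_of_empty (n : ℕ) (S T N : Set (Fin n)) (P Q : Set (Sym2 (Fin n)) → Prop)
    (hP : ∀ ⦃C C' : Set (Sym2 (Fin n))⦄, C ⊆ C' → P C → P C')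
    (hQ : ∀ ⦃C C' : Set (Sym2 (Fin n))⦄, C ⊆ C' → Q C → Q C') (hT : T = ∅) (hN : N = ∅)
    (M u : Set (Sym2 (Fin n))) :
    (Finset.univ.filter fun a : BondConfig (Fin n) =>
        a \ M = u ∧
          (∀ v ∈ N, ¬ ((∃ s ∈ S, (openGraph a).Reachable s v) ∧ (∃ s ∈ S, (openGraph (a ∆ M)).Reachable s v))) ∧
          a ∈ ({ω : BondConfig (Fin n) | ∀ s ∈ S, ∀ t ∈ T, ¬ (openGraph ω).Reachable s t} ∩
                {ω | P (⋃ s ∈ S, openEdgeCluster ω s)}) ∧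
          a ∆ M ∈ ({ω : BondConfig (Fin n) | ∀ s ∈ S, ∀ t ∈ T, ¬ (openGraph ω).Reachable s t} ∩
                {ω | Q (⋃ s ∈ S, openEdgeCluster ω s)})).card ≤
    (Finset.univ.filter fun a : BondConfig (Fin n) =>
        a \ M = u ∧
          (∀ v ∈ N, ¬ ((∃ s ∈ S, (openGraph a).Reachable s v) ∧ (∃ s ∈ S, (openGraph (a ∆ M)).Reachable s v))) ∧
          a ∈ ({ω : BondConfig (Fin n) | ∀ s ∈ S, ∀ t ∈ T, ¬ (openGraph ω).Reachable s t} ∩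
                {ω | P (⋃ s ∈ S, openEdgeCluster ω s)} ∩ {ω | Q (⋃ s ∈ S, openEdgeCluster ω s)}) ∧
          a ∆ M ∈ {ω : BondConfig (Fin n) | ∀ s ∈ S, ∀ t ∈ T, ¬ (openGraph ω).Reachable s t}).card := by
  subst hT hN
  have key := fibrewiseBHK_of_repel_empty n S P Q hP hQ M u
  convert key using 2 <;>
  · ext a
    simp only [Finset.mem_filter, Finset.mem_univ, true_and, Set.mem_empty_iff_false, false_implies, implies_true]

end Consts

end Summit.CriticalPhenomena.PercolationContinuityZ3.Theorems
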